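/-
Copyright: statement-level skeleton of a published paper (lit-balaban cell, Phase-2 proof seat p25, gen 21). No proof
claims beyond what the kernel checks below.
-/
import Literature.MathematicalPhysics.QuantumFieldTheory.BalabanImbrieJaffe1984to88.BIJ88WalkWeightedLocalitySupports

/-!
# `BalabanImbrieJaffe1984to88.BIJ88WalkSplitReach` — T. Bałaban, J. Imbrie, A. Jaffe, *Effective action and cluster
properties of the abelian Higgs model*, Commun. Math. Phys. **114** (1988) 257–315 [BalabanImbrieJaffe1988], Sect. 2
p. 264 [PDF 8], verbatim: *"Then we define C^{(k)}_Λ(u) = C^{(k)}_{Λ,loc}(u) + Σ_X C^{(k)}_{Λ,X}(u), (2.45) and the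
convergence and locality properties of the random walk expansion imply the following facts about these operators.
The local part C^{(k)}_{Λ,loc}(u; x₁, x₂) depends only on u in an O(r(e_k)) neighborhood of x₁, x₂; it vanishes for
|x₁ − x₂| > ½r(e_k) … The operator C^{(k)}_{Λ,X}(u) depends only on u in X. It vanishes unless both arguments are in
X"*, and §5.14 p. 310 [PDF 54]: *"The leading terms, with only propagators C^{(k)}_{Λ₁₂^{(k)},loc}, … we transform
further. The others, localized in region X, have a factor of e^{−cr(e_k)|X|}"* — **THE REACH DATA OF PRINT'S SPLIT
(2.45): A RANGE-LOCAL PIECE PLUS REGION PIECES** (p25 gen 21; file W4c, a MEMBER of row C2.Claim@312, owner r16,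
referee ref-5; head of record `BIJ88WalkIneq312RemainderBdry.ineq312_remainder_bdry` UNCHANGED).

`BIJ88WalkWeightedLocalitySupports.weighted_locality_of_reach` asks, per direction cube `k`, which pieces SEE `k`
and where they WRITE (`sees p k`, `reach p k`), and per-cube weight sums.  For a covariance split of print's shape
(2.45) — pieces indexed by `Option R`: `none` = the local part, vanishing unless its two arguments' cubes are `near`
(*"vanishes for |x₁ − x₂| > ½r(e_k)"*), `some r` = the part of the region `X_r`, vanishing unless both arguments'
cubes lie in `X_r` (*"vanishes unless both arguments are in X"*) — this file supplies that data from the two support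
properties of the kernels (`split_reach`: the local part sees every cube and reaches its `near`-neighbourhood, the
part of `X_r` sees and reaches exactly `X_r`), splits the per-cube sums into the local piece's share and the
lattice-animal sums of `BIJ88WalkRegionWeightsSummable` (`split_weights`), and assembles the weighted locality of the
interaction for such a split (`split_weighted_locality`).

statement-level skeleton of published theorems with citation tags; proofs where landed; nothing here is a claim
about the Yang–Mills mass gap

PDF held: `paper:balaban1988-cmp114-bij-abelian-higgs-effective-action` (journal page = PDF page + 256); p. 264 = PDF
8, p. 310 = PDF 54.

CITATION HEADER (lean-in-tree rule).  lit-balaban cell (HOME `run/shared/lean/pub/lit-balaban/`), Phase 2, seat p25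
gen 21; row **C2.Claim@312** of `HOME/lit-balaban-r16/ROWS-C2-part2.md` (owner r16, referee ref-5; MEMBER).  USED BY
NAME, nothing restated: `BIJ88WalkWeightedLocalitySupports.weighted_locality_of_reach` (p25 gen 21); the support
clauses it consumes are those PROVED for the (2.45) objects in `BIJ88RandomWalk242` (`cLoc_eq_zero_of_far`,
`cX_support`, p13) — not imported here (abstract kernels).

## What is proved (0 `sorry`, standard axioms, no new `Prop` facts; theorems only, no definitions)

* `mulVec_apply_ne_zero` (bookkeeping), **`split_reach`**, **`split_weights`**, **`split_weighted_locality`**.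
HONEST SCOPE: (a) the pieces are HYPOTHESISED kernels with the two printed support properties; neither the walk
expansion nor (2.46)'s bound is used; (b) the region pieces' per-cube sums (`a`, `b`) are inputs — for connected
regions with `ρ_r ≤ λ^{|X_r|}` they are `2λ`, `2eλ` (`BIJ88WalkRegionWeightsSummable.region_weights_summable`); (c) the
local piece's reach is bounded by the `near`-degree `D`.  NOT summit progress; NOT continuum; NOT Clay.  Imports
`BIJ88WalkWeightedLocalitySupports`; modifies nothing.
-/

noncomputable section

namespace Literature.MathematicalPhysics.QuantumFieldTheory.BalabanImbrieJaffe1984to88.BIJ88WalkSplitReach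

open Classical Matrix Finset
open scoped BigOperators
open BIJ88WalkWeightedLocalitySupports (weighted_locality_of_reach)

variable {S : Type} [Fintype S] {K : Type} [Fintype K] {R : Type} [Fintype R] {ι : Type} [Fintype ι]
  {cubeOf : S → K} {near : K → K → Prop} {X : R → Finset K} {Cov : Option R → Matrix S S ℝ}

omit [Fintype K] [Fintype R] [Fintype ι] in
/-- A nonzero entry of `C u` comes from a nonzero kernel entry against a nonzero entry of `u` (bookkeeping). [folklore] -/
private theorem mulVec_apply_ne_zero {C : Matrix S S ℝ} {u : S → ℝ} {x : S} (h : (C *ᵥ u) x ≠ 0) :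
    ∃ y, C x y ≠ 0 ∧ u y ≠ 0 := by
  obtain ⟨y, -, hy⟩ := Finset.exists_ne_zero_of_sum_ne_zero h
  have hy' : C x y * u y ≠ 0 := hy
  exact ⟨y, fun h0 => hy' (by rw [h0, zero_mul]), fun h0 => hy' (by rw [h0, mul_zero])⟩

omit [Fintype R] [Fintype ι] in
/-- **THE REACH DATA OF THE SPLIT (2.45)**: if the local part vanishes unless the cubes of its arguments are `near`
(*"vanishes for |x₁ − x₂| > ½r(e_k)"*) and the part of the region `X_r` vanishes unless both arguments' cubes lie in
`X_r` (*"vanishes unless both arguments are in X"*), then, for a direction living in the cube `k`: the local part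
writes only into the cubes `k'` with `near k k'`; the part of `X_r` is nonzero only
if `k ∈ X_r` and writes only into `X_r` — the hypotheses `hin`, `hout` of `weighted_locality_of_reach` with
`sees none k := True`, `sees (some r) k := k ∈ X_r`, `reach none k := {k' | near k k'}`, `reach (some r) k := X_r`.
[cite: BalabanImbrieJaffe1988, Sect. 2 (2.45)-(2.46) p.264; §5.14 p.310] -/
theorem split_reach (hnone : ∀ x y, Cov none x y ≠ 0 → near (cubeOf y) (cubeOf x))
    (hsome : ∀ r x y, Cov (some r) x y ≠ 0 → cubeOf x ∈ X r ∧ cubeOf y ∈ X r) :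
    (∀ p (u : S → ℝ) k, (∀ y, u y ≠ 0 → cubeOf y = k) → Cov p *ᵥ u ≠ 0 →
        (fun (p : Option R) (k : K) => Option.elim p True fun r => k ∈ X r) p k) ∧
    (∀ p (u : S → ℝ) k, (∀ y, u y ≠ 0 → cubeOf y = k) → ∀ x, (Cov p *ᵥ u) x ≠ 0 →
        cubeOf x ∈ (fun (p : Option R) (k : K) => Option.elim p (univ.filter fun k' => near k k') fun r => X r) p k) := by
  constructor
  · intro p u k hk hp
    cases p with
    | none => trivial
    | some r =>
      obtain ⟨x, hx⟩ := Function.ne_iff.mp hp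
      have hx' : (Cov (some r) *ᵥ u) x ≠ 0 := by simpa using hx
      obtain ⟨y, hy, huy⟩ := mulVec_apply_ne_zero hx'
      simp only [Option.elim]
      rw [← hk y huy]
      exact (hsome r x y hy).2
  · intro p u k hk x hx
    obtain ⟨y, hy, huy⟩ := mulVec_apply_ne_zero hx
    cases p with
    | none =>
      simp only [Option.elim, Finset.mem_filter, Finset.mem_univ, true_and]
      rw [← hk y huy]
      exact hnone x y hy
    | some r =>
      simp only [Option.elim]
      exact (hsome r x y hy).1

omit [Fintype S] [Fintype ι] in
/-- **THE PER-CUBE WEIGHT SUMS OF THE SPLIT**: with the reach data of `split_reach`, weights `ρ ≥ 0`, a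
`near`-degree `≤ D`, and the region pieces' sums through every cube bounded by `a` (plain) and `b` (with `|X_r|`):
`Σ_{p : sees p k} ρ_p ≤ ρ_loc + a` and `Σ_{p : sees p k} ρ_p·|reach p k| ≤ ρ_loc·D + b`.
[cite: BalabanImbrieJaffe1988, §5.14 p.310; Sect. 2 p.264–265] -/
theorem split_weights {ρ : Option R → ℝ} {a b : ℝ} {D : ℕ} (hρ : ∀ p, 0 ≤ ρ p)
    (hD : ∀ k, (univ.filter fun k' => near k k').card ≤ D)
    (ha : ∀ k, (∑ r ∈ univ.filter (fun r => k ∈ X r), ρ (some r)) ≤ a)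
    (hb : ∀ k, (∑ r ∈ univ.filter (fun r => k ∈ X r), ρ (some r) * (X r).card) ≤ b) (k : K) :
    (∑ p ∈ univ.filter (fun p => (fun (p : Option R) (k : K) => Option.elim p True fun r => k ∈ X r) p k), ρ p)
        ≤ ρ none + a ∧
    (∑ p ∈ univ.filter (fun p => (fun (p : Option R) (k : K) => Option.elim p True fun r => k ∈ X r) p k),
        ρ p * ((fun (p : Option R) (k : K) =>
          Option.elim p (univ.filter fun k' => near k k') fun r => X r) p k).card) ≤ ρ none * D + b := by
  set F : Finset R := univ.filter fun r => k ∈ X r with hF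
  -- the pieces seeing `k`: the local one, and the region pieces through `k`
  have hsub : univ.filter (fun p => (fun (p : Option R) (k : K) => Option.elim p True fun r => k ∈ X r) p k)
      ⊆ insert none (F.map Function.Embedding.some) := by
    intro p hp
    rw [Finset.mem_filter] at hp
    cases p with
    | none => exact Finset.mem_insert_self _ _
    | some r =>
      exact Finset.mem_insert_of_mem (Finset.mem_map.2 ⟨r, Finset.mem_filter.2 ⟨Finset.mem_univ _, hp.2⟩, rfl⟩)
  have hnot : none ∉ F.map Function.Embedding.some := by simp
  constructor
  · calc _ ≤ ∑ p ∈ insert none (F.map Function.Embedding.some), ρ p :=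
          Finset.sum_le_sum_of_subset_of_nonneg hsub fun p _ _ => hρ p
      _ = ρ none + ∑ r ∈ F, ρ (some r) := by
          rw [Finset.sum_insert hnot, Finset.sum_map]
          simp only [Function.Embedding.some_apply]
      _ ≤ ρ none + a := add_le_add le_rfl (ha k)
  · calc _ ≤ ∑ p ∈ insert none (F.map Function.Embedding.some), ρ p * ((fun (p : Option R) (k : K) =>
            Option.elim p (univ.filter fun k' => near k k') fun r => X r) p k).card :=
          Finset.sum_le_sum_of_subset_of_nonneg hsub fun p _ _ => mul_nonneg (hρ p) (Nat.cast_nonneg _)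
      _ = ρ none * ((univ.filter fun k' => near k k').card : ℕ) + ∑ r ∈ F, ρ (some r) * (X r).card := by
          rw [Finset.sum_insert hnot, Finset.sum_map]
          simp only [Function.Embedding.some_apply, Option.elim]
      _ ≤ ρ none * D + b := add_le_add (mul_le_mul_of_nonneg_left (by exact_mod_cast hD k) (hρ none)) (hb k)

/-- **THE WEIGHTED LOCALITY OF THE INTERACTION FOR A SPLIT OF PRINT'S SHAPE (2.45)**: kernels with the two printed
support properties (`hnone`, `hsome`), directions in one cube, vertex legs in one cube with at most `L` per cube,
weights `ρ ≥ 0`, `near`-degree `≤ D`, region sums `a`, `b` per cube.  Then for every `u ∈ Dir`: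
`Σ_{p : C_p u ≠ 0} ρ_p ≤ ρ_loc + a` and `Σ_p ρ_p·#{(m,j) : ⟨C_p u,(legs m)_j⟩ ≠ 0} ≤ L·(ρ_loc·D + b)` — the inputs
`hρ₀`, `hρN` of `BIJ88WalkLocalCountW312.run_lsum_le_W` / `BIJ88WalkIneq312WeightedLocality.ineq312_remainder_bdry_W`,
uniformly in the volume. [cite: BalabanImbrieJaffe1988, §5.14 p.310; Sect. 2 (2.45)-(2.46) p.264–265] -/
theorem split_weighted_locality {legs : ι → List (S → ℝ)} {legCube : ι → ℕ → K} {Dir : Set (S → ℝ)}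
    (hnone : ∀ x y, Cov none x y ≠ 0 → near (cubeOf y) (cubeOf x))
    (hsome : ∀ r x y, Cov (some r) x y ≠ 0 → cubeOf x ∈ X r ∧ cubeOf y ∈ X r)
    (hDir : ∀ u ∈ Dir, ∃ k, ∀ y, u y ≠ 0 → cubeOf y = k)
    (hleg : ∀ m j x, ((legs m).getD j 0) x ≠ 0 → cubeOf x = legCube m j) {L : ℕ}
    (hL : ∀ k, (∑ m, ((range (legs m).length).filter fun j => legCube m j = k).card) ≤ L)
    {ρ : Option R → ℝ} (hρ : ∀ p, 0 ≤ ρ p) {a b : ℝ} {D : ℕ} (hD : ∀ k, (univ.filter fun k' => near k k').card ≤ D)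
    (ha : ∀ k, (∑ r ∈ univ.filter (fun r => k ∈ X r), ρ (some r)) ≤ a)
    (hb : ∀ k, (∑ r ∈ univ.filter (fun r => k ∈ X r), ρ (some r) * (X r).card) ≤ b) :
    (∀ u ∈ Dir, (∑ p ∈ univ.filter (fun p => Cov p *ᵥ u ≠ 0), ρ p) ≤ ρ none + a) ∧
    (∀ u ∈ Dir, (∑ p, ρ p *
      ((∑ m, ((range (legs m).length).filter fun j => (Cov p *ᵥ u) ⬝ᵥ (legs m).getD j 0 ≠ 0).card : ℕ) : ℝ))
        ≤ L * (ρ none * D + b)) := by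
  obtain ⟨hin, hout⟩ := split_reach (Cov := Cov) hnone hsome
  have hw := fun k => split_weights (near := near) (X := X) hρ hD ha hb k
  exact weighted_locality_of_reach (Cov := Cov) (legs := legs) (Dir := Dir) hin hout hDir hleg hL hρ
    (fun k => (hw k).1) (fun k => (hw k).2)

end Literature.MathematicalPhysics.QuantumFieldTheory.BalabanImbrieJaffe1984to88.BIJ88WalkSplitReach

end
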